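import Summits.AtomisticToContinuum.FouriersLaw.Theses.CageBudgetFekete
import Summits.AtomisticToContinuum.FouriersLaw.Theorems.CageBudgetFeketeUnboundedHeatVarianceCurrentSpectralMeasure
import Summits.AtomisticToContinuum.FouriersLaw.Theorems.CageBudgetFeketeUnboundedHeatVarianceSpectralHeatVarianceUnbounded
import Summits.AtomisticToContinuum.FouriersLaw.Theorems.CageBudgetFeketeUnboundedHeatVarianceAbelForm

/-!
# Birth skeleton (BC3) of crux `CageBudgetFekete.UnboundedHeatVariance`
(item `stmt-AtomisticToContinuum-15771`, route `route-AtomisticToContinuum-CageBudgetFekete`, rank 4,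
sub-problem `FouriersLaw`; registrar `planner-skel-stmt-AtomisticToContinuum-15771-0`, 2026-08-17)

Crux (FIXED, concluded BY NAME below). Arena (shared with the route's other analytic cruxes): the
infinite pinned chain `pinnedChain ω₂ lam β γ` (`ω₂, lam, β > 0`), `T > 0`, a shift- and
momentum-reversal-invariant DLR Gibbs state `μ`, a `μ`-preserving `InfiniteChainDynamics D` commuting
with the shift a.e., absolutely convergent summed current correlations `C(t) = D.currentCorrelation μ t`
at every `t`, `C` continuous, and the EQUILIBRIUM HEAT VARIANCE `V(τ) = 2∫₀^τ (τ − s) C(s) ds`.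
Claim (U): `∀ R ∃ τ ≥ 0, R < V τ` — the time-integrated total current is unbounded in `ℋ₀`
(`J` is not an exact `L²`-coboundary of the infinite-volume Liouvillian).

## Line `birth` — CURRENT SPECTRAL MEASURE × INFRARED NON-INTEGRABILITY × CESÀRO–FATOU

Write `C(t) = ∫ cos(ωt) dρ(ω)` (`t ≥ 0`) for a finite positive measure `ρ` on `ℝ` — the spectral
measure of the current class `[J]` under the Koopman group (Helfand / Bochner). Then, by Fubini,
`V(τ) = ∫ 2(1 − cos ωτ)/ω² dρ(ω)` (integrand `= τ²` at `ω = 0`), and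

  `sup_τ V(τ) = ∞  ⟺  ρ{0} > 0 (a Drude atom)  ∨  ∫_{ω ≠ 0} ω⁻² dρ(ω) = ∞`

(von Neumann's mean-ergodic / coboundary dichotomy in spectral form: `V` bounded iff
`[J] = L u` with `u ∈ ℋ₀` iff `∫ ω⁻² dρ < ∞` and no atom). The line is the three pieces of this:

* `stub_currentSpectralMeasure` (S1, HELFAND–BOCHNER REPRESENTATION; size L, provable from the arena):
  there is a finite measure `ρ` on `ℝ` with `C(t) = ∫ cos(ωt) dρ(ω)` for all `t ≥ 0`. Mechanism: `C`
  is real, even (stationarity + shift invariance) and of positive type — `Σ cᵢcⱼ C(τⱼ − τᵢ) =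
  lim_N N⁻¹ ‖Σᵢ cᵢ J_N ∘ φ_{τᵢ}‖²_{L²(μ)} ≥ 0` with `J_N = Σ_{x<N} j_x`, the Fejér-weighted sums
  converging by `HasAbsConvergentCorrelation` — and continuous (arena); the cosine Bochner theorem is
  LANDED (`Theorems.MourreDissolution.stub_cosineBochner` / `…isPositiveDefinite_ofReal`,
  `Literature.Analysis.FunctionSpaces.IsPositiveDefinite.exists_charFun_eq_holds`); for Doyon data the
  positive type is LANDED too (`ZeroWavenumberData.sum_mul_currentCorrelation_nonneg`,
  `FluctuationDynamics.sum_mul_inner_koopman_nonneg`). In this arena (no clustering beyond absolute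
  convergence of the CURRENT correlations) the Fejér argument must be run directly in `L²(μ)`.
* `stub_infraredCurrentSpectrum` (S2, THE LOAD-BEARING PHYSICS; open): every finite `ρ` representing
  `C` on `t ≥ 0` charges the infrared: `0 < ρ{0} ∨ ¬ Integrable (ω ↦ (ω²)⁻¹) ρ` (Lean's `(0²)⁻¹ = 0`
  makes the integrability clause exactly `∫_{ω≠0} ω⁻² dρ < ∞`). Equivalent forms (the attack): the
  Abel function `A(ν) = ∫₀^∞ e^{−νt}C = ∫ ν/(ν²+ω²) dρ` satisfies `A(ν)/ν = ∫ dρ/(ν²+ω²) ↑ ∞`, i.e.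
  `A(ν) ≠ O(ν)` as `ν ↓ 0` — MUCH weaker than positivity of the Abel–Green–Kubo limit (which the
  route obtains afterwards from U + Q + C); variationally `A(ν)/ν = sup_u [2⟨u,[J]⟩₀ − ν²‖u‖₀² −
  ‖Lu‖₀²]`, so S2 ⟺ there are local observables `u_k` with `⟨u_k, [J]⟩₀ = 1` and
  `ν_k²‖u_k‖₀² + ‖L u_k‖₀² → 0` for some `ν_k ↓ 0` (approximately conserved odd observables
  overlapping the current). Fails exactly for insulators (`σ_J(ω) = O(ω²)`-soft spectrum:
  Anderson-localised / asymptotically localised chains, `AjankiHuveneers2011_scaling`,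
  `DeRoeckHuveneers2015_thm2`), which is the crux's own recorded way to fail.
* `stub_spectralHeatVarianceUnbounded` (S3, CESÀRO–FATOU CRITERION; pure real analysis, size M,
  provable now): for a finite `ρ` with `0 < ρ{0} ∨ ¬ Integrable (ω ↦ (ω²)⁻¹) ρ`, the function
  `τ ↦ 2∫₀^τ (τ − s)(∫ cos(ωs) dρ) ds` is unbounded above on `τ ≥ 0`. Proof: Fubini gives
  `∫ 2(1 − cos ωτ)/ω² dρ ≥ 0`; an atom gives `≥ ρ{0}τ²`; otherwise the Cesàro mean
  `T⁻¹∫₀^T V = ∫ (2/ω²)(1 − sin(ωT)/(ωT)) dρ ≥ ∫_{|ω| ≥ 2/T} ω⁻² dρ ↑ ∞` (monotone convergence), so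
  some `τ ∈ [0, T]` has `V(τ) > R`.

COMPOSITION `UnboundedHeatVariance_of` (sorry-free, ≈ 10 lines of logic): S1 gives `ρ`, S2 its
infrared charge, S3 a time `τ ≥ 0` with `R < 2∫₀^τ(τ−s)(∫cos) ds = V τ` (rewrite `C = ∫cos dρ` under
`∫_{(0,τ]}` by `setIntegral_congr_fun`).

Why the cut is not a costume / not shredded: S1 alone holds at the harmonic member AND for every
insulator; S2 alone is vacuous without a representing measure and is strictly weaker than U-with-rate
statements (`κ > 0`); S3 is a theorem of harmonic analysis about an arbitrary finite measure. No stub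
mentions `V`'s unboundedness or `FouriersLaw`; BC3 probes `stub → UnboundedHeatVariance` and
`stub → FouriersLaw` by `first | exact? | simpa | aesop` FAIL for all three (planner folder
`bc/stub*_probe.lean`, quoted in `Lines/birth.md`). Calibration: harmonic member `ρ = C(0)·δ₀`
(atom: S2 true by the first disjunct, U true, the route fails at the ceiling crux instead — as its
header records); kinetic corner `ρ(dω) = ⟨h, δ(ω − L̃)h⟩` absolutely continuous with density
`> 0` at `0` (second disjunct).

Disproof used: none on file (`ledger crux ls stmt-AtomisticToContinuum-15771`: no `Disproof.lean`,
no `Negative/` lemma, 2026-08-17); negatives index: no FouriersLaw entry bears on S1–S3. Refuter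
route-review (evidence REVIEW-CageBudgetFekete.md): "precise, guards exclude junk, not junk-false
(C_T(0) > 0)" — all three stubs keep the full guard prefix verbatim.

LEAD STATUS (prover-line-stmt-AtomisticToContinuum-15771-0, 2026-08-17, cycle 1): S1 `stub_currentSpectralMeasure`
LANDED (p161048, `Theorems/CageBudgetFeketeUnboundedHeatVarianceCurrentSpectralMeasure.lean`) and S3
`stub_spectralHeatVarianceUnbounded` LANDED (p161386,
`Theorems/CageBudgetFeketeUnboundedHeatVarianceSpectralHeatVarianceUnbounded.lean`); both `Holds.stub_*` below are now
`exact` the landed theorems. S2 reshaped ↦ S2′ `stub_abelDivergence` (Abel form) + glue G `stub_infraredOfAbelDivergence` (LANDED p162185,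
`Theorems/CageBudgetFeketeUnboundedHeatVarianceAbelForm.lean`, with U ⟺ S2 ⟺ S2′ kernel-checked there).
ONE sorry left: S2′ `stub_abelDivergence` (the crux's open content), held by the lead.

Registered stubs (3): `stub_currentSpectralMeasure`, `stub_infraredCurrentSpectrum`,
`stub_spectralHeatVarianceUnbounded` — each a sorried theorem `Holds.stub_<name> : <statement> := by
sorry` (registered by `ledger skeleton check` under the short name with that text as signature) plus
the by-name handle `def stub_<name> : Prop := type_of% Holds.stub_<name>` used as the hypotheses of
`UnboundedHeatVariance_of` (layer-invariant audit `#h21_check_skeleton`: hypotheses by name).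
-/

noncomputable section

namespace Summit.AtomisticToContinuum.FouriersLaw.Cruxes.UnboundedHeatVariance.Birth

open MeasureTheory Set

/-! ## Part I — registered stubs (the lemmas of the line; `sorry` only here) -/

/-- **S1 — `stub_currentSpectralMeasure` (Helfand–Bochner representation of the summed current
autocorrelation; size L).** In the crux's arena there is a finite positive measure `ρ` on `ℝ` (the
spectral measure of the current class) with `C(t) = ∫ cos(ωt) dρ(ω)` for every `t ≥ 0`.
Why plausibly true: `C` is continuous (arena), even and of positive type (Fejér limit of
`N⁻¹‖Σ cᵢ J_N∘φ_{τᵢ}‖²_{L²(μ)} ≥ 0`, using measure preservation, the a.e. group law, a.e.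
shift-commutation and `HasAbsConvergentCorrelation`), and the cosine Bochner theorem is landed
(`Theorems.MourreDissolution.stub_cosineBochner`). [folklore; Helfand1960; Bochner 1933] -/
theorem Holds.stub_currentSpectralMeasure :
    ∀ ω₂ lam β γ : ℝ, 0 < ω₂ → 0 < lam → 0 < β → ∀ T : ℝ, 0 < T → ∀ μ : MeasureTheory.Measure Literature.MathematicalPhysics.KineticTheory.HeatConduction.ChainConfig, (Literature.MathematicalPhysics.KineticTheory.HeatConduction.pinnedChain ω₂ lam β γ).IsChainGibbsMeasure T μ → Literature.MathematicalPhysics.KineticTheory.HeatConduction.IsShiftInvariant μ → μ.map (fun σ : Literature.MathematicalPhysics.KineticTheory.HeatConduction.ChainConfig => fun x : ℤ => ((σ x).1, -(σ x).2)) = μ → ∀ D : Literature.MathematicalPhysics.KineticTheory.HeatConduction.InfiniteChainDynamics (Literature.MathematicalPhysics.KineticTheory.HeatConduction.pinnedChain ω₂ lam β γ), D.PreservesMeasure μ → (∀ t : ℝ, ∀ᵐ σ ∂μ, D.flow t (Literature.MathematicalPhysics.KineticTheory.HeatConduction.shift σ) = Literature.MathematicalPhysics.KineticTheory.HeatConduction.shift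 (D.flow t σ)) → (∀ t : ℝ, D.HasAbsConvergentCorrelation μ t) → Continuous (fun t : ℝ => D.currentCorrelation μ t) → ∃ ρ : MeasureTheory.Measure ℝ, MeasureTheory.IsFiniteMeasure ρ ∧ ∀ t : ℝ, 0 ≤ t → D.currentCorrelation μ t = ∫ w : ℝ, Real.cos (w * t) ∂ρ := by
  exact _root_.Summit.AtomisticToContinuum.FouriersLaw.Theorems.UnboundedHeatVariance.Birth.stub_currentSpectralMeasure

/-- **S2′ — `stub_abelDivergence` (ABEL FORM of the infrared charge; the load-bearing physics, open;
reshaped by the lead at cycle 1 from S2 `stub_infraredCurrentSpectrum`).** In the crux's arena the normalised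
Abel function of the summed current autocorrelation diverges at the origin:
`ν⁻¹ ∫_{t>0} e^{-νt} C(t) dt → +∞` as `ν ↓ 0` — i.e. `A(ν) = ∫₀^∞ e^{-νt}C` is NOT `O(ν)`. No spectral measure
in the statement; by the landed Laplace identity of `HeatVarianceCalculus` this is `(ν/2)∫₀^∞e^{-νt}V(t)dt → ∞`
(Abel means of the heat variance diverge), and by `FluctuationAbelPositivity` (Doyon data) it reads
`‖(ν - L)⁻¹[J]‖²_{ℋ₀} → ∞`: the resolvent of the infinite-volume Liouvillian applied to the current class blows up
at `0`, i.e. `[J] ∉ Range L`. EQUIVALENT to S2 and to U (landed `Theorems…Birth.unboundedHeatVariance_iff_abel`,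
this cycle). Sufficient: any positive Abel–Green–Kubo floor `liminf_{ν↓0} A(ν) > 0`. Why it might fail: exactly
for an insulating infrared `A(ν) = O(ν)` (asymptotically localised / Anderson chains — excluded here only by the
bet on translation invariance + `T > 0`). [DeRoeckHuveneers2015; AjankiHuveneers2011; Doyon2022 §4–5;
BonettoLebowitzReyBellet2000 §7] -/
theorem Holds.stub_abelDivergence :
    ∀ ω₂ lam β γ : ℝ, 0 < ω₂ → 0 < lam → 0 < β → ∀ T : ℝ, 0 < T → ∀ μ : MeasureTheory.Measure Literature.MathematicalPhysics.KineticTheory.HeatConduction.ChainConfig, (Literature.MathematicalPhysics.KineticTheory.HeatConduction.pinnedChain ω₂ lam β γ).IsChainGibbsMeasure T μ → Literature.MathematicalPhysics.KineticTheory.HeatConduction.IsShiftInvariant μ → μ.map (fun σ : Literature.MathematicalPhysics.KineticTheory.HeatConduction.ChainConfig => fun x : ℤ => ((σ x).1, -(σ x).2)) = μ → ∀ D : Literature.MathematicalPhysics.KineticTheory.HeatConduction.InfiniteChainDynamics (Literature.MathematicalPhysics.KineticTheory.HeatConduction.pinnedChain ω₂ lam β γ), D.PreservesMeasure μ → (∀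 t : ℝ, ∀ᵐ σ ∂μ, D.flow t (Literature.MathematicalPhysics.KineticTheory.HeatConduction.shift σ) = Literature.MathematicalPhysics.KineticTheory.HeatConduction.shift (D.flow t σ)) → (∀ t : ℝ, D.HasAbsConvergentCorrelation μ t) → Continuous (fun t : ℝ => D.currentCorrelation μ t) → Filter.Tendsto (fun ν : ℝ => ν⁻¹ * ∫ t in Set.Ioi (0:ℝ), Real.exp (-(ν * t)) * D.currentCorrelation μ t) (nhdsWithin (0:ℝ) (Set.Ioi 0)) Filter.atTop := by
  sorry

/-- **G — `stub_infraredOfAbelDivergence` (glue of the reshaping S2 ↦ S2′; pure real analysis, provable now,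
size S).** For ANY kernel `C` whose normalised Abel function `ν⁻¹∫_{t>0}e^{-νt}C(t)dt` diverges as `ν ↓ 0`,
every finite measure `ρ` representing `C` on `t ≥ 0` charges the infrared (`0 < ρ{0} ∨ (ω²)⁻¹ ∉ L¹(ρ)`):
`ν⁻¹A(ν) = ∫ (ν²+ω²)⁻¹ dρ` (Fubini + Laplace transform of the cosine, landed
`AbelOfSpectralDensity.integral_exp_neg_mul_cosTransform`), and without atom and with `(ω²)⁻¹ ∈ L¹(ρ)` these
Poisson integrals are capped by `∫(ω²)⁻¹dρ`. [folklore] -/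
theorem Holds.stub_infraredOfAbelDivergence :
    ∀ C : ℝ → ℝ, Filter.Tendsto (fun ν : ℝ => ν⁻¹ * ∫ t in Set.Ioi (0:ℝ), Real.exp (-(ν * t)) * C t) (nhdsWithin (0:ℝ) (Set.Ioi 0)) Filter.atTop → ∀ ρ : MeasureTheory.Measure ℝ, MeasureTheory.IsFiniteMeasure ρ → (∀ t : ℝ, 0 ≤ t → C t = ∫ w : ℝ, Real.cos (w * t) ∂ρ) → 0 < ρ {0} ∨ ¬ MeasureTheory.Integrable (fun w : ℝ => (w ^ 2)⁻¹) ρ := by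
  exact _root_.Summit.AtomisticToContinuum.FouriersLaw.Theorems.UnboundedHeatVariance.Birth.stub_infraredOfAbelDivergence

/-- **S2 — `stub_infraredCurrentSpectrum` (the current spectral measure charges the infrared)** — no longer a
stub: it is S2′ composed with the glue G (reshaping of cycle 1). In the crux's arena, every finite measure `ρ`
on `ℝ` representing `C` on `t ≥ 0` has an atom at `0` or `∫_{ω≠0} ω⁻² dρ = ∞` (Lean: `¬ Integrable (fun ω =>
(ω^2)⁻¹) ρ`, the integrand being `0` at `ω = 0`). [DeRoeckHuveneers2015; AjankiHuveneers2011; Mazur1969;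
Doyon2022 §4–5] -/
theorem Holds.stub_infraredCurrentSpectrum :
    ∀ ω₂ lam β γ : ℝ, 0 < ω₂ → 0 < lam → 0 < β → ∀ T : ℝ, 0 < T → ∀ μ : MeasureTheory.Measure Literature.MathematicalPhysics.KineticTheory.HeatConduction.ChainConfig, (Literature.MathematicalPhysics.KineticTheory.HeatConduction.pinnedChain ω₂ lam β γ).IsChainGibbsMeasure T μ → Literature.MathematicalPhysics.KineticTheory.HeatConduction.IsShiftInvariant μ → μ.map (fun σ : Literature.MathematicalPhysics.KineticTheory.HeatConduction.ChainConfig => fun x : ℤ => ((σ x).1, -(σ x).2)) = μ → ∀ D : Literature.MathematicalPhysics.KineticTheory.HeatConduction.InfiniteChainDynamics (Literature.MathematicalPhysics.KineticTheory.HeatConduction.pinnedChain ω₂ lam β γ), D.PreservesMeasure μ → (∀ t : ℝ, ∀ᵐ σ ∂μ, D.flow t (Literature.MathematicalPhysics.KineticTheory.HeatConduction.shift σ) = Literature.MathematicalPhysics.KineticTheory.HeatConduction.shift (D.flow t σ)) → (∀ t : ℝ, D.HasAbsConvergentCorrelation μ t) → Continuous (fun t : ℝ => D.currentCorrelation μ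 t) → ∀ ρ : MeasureTheory.Measure ℝ, MeasureTheory.IsFiniteMeasure ρ → (∀ t : ℝ, 0 ≤ t → D.currentCorrelation μ t = ∫ w : ℝ, Real.cos (w * t) ∂ρ) → 0 < ρ {0} ∨ ¬ MeasureTheory.Integrable (fun w : ℝ => (w ^ 2)⁻¹) ρ :=
  fun ω₂ lam β γ hω hl hβ T hT μ hG hSI hRefl D hP hShift hAC hCc ρ hfin hrep =>
    Holds.stub_infraredOfAbelDivergence (fun t : ℝ => D.currentCorrelation μ t)
      (Holds.stub_abelDivergence ω₂ lam β γ hω hl hβ T hT μ hG hSI hRefl D hP hShift hAC hCc) ρ hfin hrep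

/-- **S3 — `stub_spectralHeatVarianceUnbounded` (Cesàro–Fatou criterion; pure real analysis,
size M).** For a finite measure `ρ` on `ℝ` with an atom at `0` or `∫_{ω≠0} ω⁻² dρ = ∞`, the spectral
heat variance `τ ↦ 2∫₀^τ (τ − s)(∫ cos(ωs) dρ(ω)) ds = ∫ 2(1 − cos ωτ)/ω² dρ(ω)` is unbounded above
on `τ ≥ 0` (Fubini; an atom gives `≥ ρ{0}τ²`; otherwise the Cesàro means
`T⁻¹∫₀^T V ≥ ∫_{|ω|≥2/T} ω⁻² dρ ↑ ∞` by monotone convergence). The converse also holds (no atom and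
`∫ ω⁻² dρ < ∞` give `V ≤ 4∫ ω⁻² dρ`), so S2 is exactly what U needs of `ρ`. [folklore; von Neumann
mean-ergodic / coboundary dichotomy in spectral form] -/
theorem Holds.stub_spectralHeatVarianceUnbounded :
    ∀ ρ : MeasureTheory.Measure ℝ, MeasureTheory.IsFiniteMeasure ρ → (0 < ρ {0} ∨ ¬ MeasureTheory.Integrable (fun w : ℝ => (w ^ 2)⁻¹) ρ) → ∀ R : ℝ, ∃ τ : ℝ, 0 ≤ τ ∧ R < 2 * ∫ s in Set.Ioc (0:ℝ) τ, (τ - s) * (∫ w : ℝ, Real.cos (w * s) ∂ρ) := by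
  exact _root_.Summit.AtomisticToContinuum.FouriersLaw.Theorems.UnboundedHeatVariance.Birth.stub_spectralHeatVarianceUnbounded

/-! ### By-name handles of the three statements (no second copy of the text) -/

/-- Statement of registered stub S1 (`Holds.stub_currentSpectralMeasure`), by name. -/
def stub_currentSpectralMeasure : Prop := type_of% Holds.stub_currentSpectralMeasure

/-- Statement of S2 (`Holds.stub_infraredCurrentSpectrum`, no longer a stub), by name. -/
def stub_infraredCurrentSpectrum : Prop := type_of% Holds.stub_infraredCurrentSpectrum

/-- Statement of registered stub S2′ (`Holds.stub_abelDivergence`), by name. -/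
def stub_abelDivergence : Prop := type_of% Holds.stub_abelDivergence

/-- Statement of registered glue stub G (`Holds.stub_infraredOfAbelDivergence`), by name. -/
def stub_infraredOfAbelDivergence : Prop := type_of% Holds.stub_infraredOfAbelDivergence

/-- Statement of registered stub S3 (`Holds.stub_spectralHeatVarianceUnbounded`), by name. -/
def stub_spectralHeatVarianceUnbounded : Prop := type_of% Holds.stub_spectralHeatVarianceUnbounded

/-! ## Part II — the skeleton theorem: the open stub S2′ and the glue G give the crux BY NAME (sorry-free) -/

/-- **`UnboundedHeatVariance_of`** — `stub_abelDivergence → CageBudgetFekete.UnboundedHeatVariance` (kernel-checked; the LANDED S1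
`Theorems.UnboundedHeatVariance.Birth.stub_currentSpectralMeasure` gives `ρ`, S2′ + G its infrared charge, the
LANDED S3 `Theorems.UnboundedHeatVariance.Birth.stub_spectralHeatVarianceUnbounded` a time `τ ≥ 0` beating `R`;
one rewrite `C = ∫cos dρ` under `∫_{(0,τ]}`; axioms propext / Classical.choice / Quot.sound). Reshaped by the lead
at cycle 1 (S1, S3 landed; S2 ↦ S2′ + G). [folklore] -/
theorem UnboundedHeatVariance_of (h₁ : stub_abelDivergence) :
    _root_.Summit.AtomisticToContinuum.FouriersLaw.Theses.CageBudgetFekete.UnboundedHeatVariance := by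
  intro ω₂ lam β γ hω hl hβ T hT μ hG hSI hRefl D hP hShift hAC hCc V hV R
  obtain ⟨ρ, hfin, hrep⟩ :=
    Holds.stub_currentSpectralMeasure ω₂ lam β γ hω hl hβ T hT μ hG hSI hRefl D hP hShift hAC hCc
  have hIR : 0 < ρ {0} ∨ ¬ MeasureTheory.Integrable (fun w : ℝ => (w ^ 2)⁻¹) ρ :=
    Holds.stub_infraredOfAbelDivergence (fun t : ℝ => D.currentCorrelation μ t)
      (h₁ ω₂ lam β γ hω hl hβ T hT μ hG hSI hRefl D hP hShift hAC hCc) ρ hfin hrep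
  obtain ⟨τ, hτ0, hRτ⟩ := Holds.stub_spectralHeatVarianceUnbounded ρ hfin hIR R
  refine ⟨τ, hτ0, ?_⟩
  have hint : (∫ s in Set.Ioc (0:ℝ) τ, (τ - s) * D.currentCorrelation μ s) =
      ∫ s in Set.Ioc (0:ℝ) τ, (τ - s) * (∫ w : ℝ, Real.cos (w * s) ∂ρ) :=
    MeasureTheory.setIntegral_congr_fun measurableSet_Ioc fun s hs => by rw [hrep s hs.1.le]
  have hVτ : V τ = 2 * ∫ s in Set.Ioc (0:ℝ) τ, (τ - s) * (∫ w : ℝ, Real.cos (w * s) ∂ρ) := by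
    rw [hV, ← hint]
  rw [hVτ]
  exact hRτ

/-- D-0027 §3.3 shape: the crux from the remaining stubs (an `example`, so that `UnboundedHeatVariance_of`
stays the unique theorem concluding the crux; it becomes a proof once the `sorry`s of
`Holds.stub_abelDivergence` / `Holds.stub_infraredOfAbelDivergence` are discharged). -/
example : _root_.Summit.AtomisticToContinuum.FouriersLaw.Theses.CageBudgetFekete.UnboundedHeatVariance :=
  UnboundedHeatVariance_of Holds.stub_abelDivergence

end Summit.AtomisticToContinuum.FouriersLaw.Cruxes.UnboundedHeatVariance.Birth

end
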